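import Summits.Ventures.PercRepro.C025ProfileOneCircuitB

/-!
# THEOREM 𝒞(q) WITH THE HYPOTHESES IN INDEPENDENCE TERMS (night-3 g14)
`proofs/NIGHT3-G14-SIZE.md` §5c. The class 𝒞(q) of `C025ProfileOneCircuitA/B` is stated there with the cell's `rkN`: a 3-set `K` of rank 2
and `rkN M X = X.card` for every set of `≤ q + 2` points not containing `K`. Here the same theorem is restated with Mathlib's `M.Indep`:
`K` is a DEPENDENT 3-set (with the class hypothesis it is then a circuit: every proper subset is independent) and every set of at most
`q + 2` points not containing `K` is INDEPENDENT — `profileIneq_oneCircuit_indep`, `hallIneq_oneCircuit_indep`; plus the instances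
`(6, 7)`, `(7, 8)`, `(8, 9)` (`profileIneq_six_seven_oneCircuit`, …), the rows where the simple rule of ThinRow A–F fails at `n = 2q + 2`.
-/
open scoped Matroid
namespace PercRepro
open Set Finset ThmH Staged
namespace OneCircuit
variable {α : Type} [DecidableEq α] {M : Matroid α} [M.Finite]

omit [DecidableEq α] in
/-- An independent finset has `rkN` equal to its cardinality. -/
theorem rkN_eq_card_of_indep {X : Finset α} (hX : M.Indep (X : Set α)) : rkN M X = X.card := by
  rw [rkN_eq_iff, hX.eRk_eq_encard, Set.encard_coe_eq_coe_finsetCard]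

/-- **THEOREM 𝒞(q), independence form**: `q ≥ 2`, `K ⊆ E` a dependent 3-set, every set of `≤ q + 2` points not containing `K`
independent ⇒ the row `(q, q+1)` of (Π) and its Hall form. -/
theorem profileIneq_oneCircuit_indep (q : ℕ) (hq : 2 ≤ q) (K : Finset α) (hKE : (K : Set α) ⊆ M.E) (hK3 : K.card = 3)
    (hKdep : ¬ M.Indep (K : Set α))
    (hclass : ∀ X : Finset α, (X : Set α) ⊆ M.E → X.card ≤ q + 2 → ¬ K ⊆ X → M.Indep (X : Set α)) :
    Profile.ProfileIneq M q (q + 1) ∧ Profile.HallIneq M q (q + 1) := by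
  have hKg : K ⊆ gr M := by
    intro k hk
    have : k ∈ ((gr M : Finset α) : Set α) := by rw [coe_gr]; exact hKE hk
    exact_mod_cast this
  have hclass' : ∀ X ⊆ gr M, X.card ≤ q + 2 → ¬ K ⊆ X → rkN M X = X.card := by
    intro X hXg hXc hKX
    have hXE : (X : Set α) ⊆ M.E := by rw [← coe_gr]; exact_mod_cast hXg
    exact rkN_eq_card_of_indep (hclass X hXE hXc hKX)
  -- `ρ(K) = 2`: `K` is dependent (`≤ 2`) and `K ∖ {k}` is independent (`≥ 2`)
  have hKrk : rkN M K = 2 := by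
    have hle : rkN M K ≤ 2 := by
      by_contra h
      push Not at h
      have h3 : rkN M K = 3 := le_antisymm (hK3 ▸ rkN_le_card K) (by omega)
      apply hKdep
      rw [Matroid.indep_iff_eRk_eq_encard_of_finite K.finite_toSet, Set.encard_coe_eq_coe_finsetCard, hK3, ← rkN_eq_iff, h3]
    obtain ⟨k, hk⟩ : K.Nonempty := Finset.card_pos.mp (by omega)
    have hKk : rkN M (K.erase k) = (K.erase k).card :=
      hclass' _ ((Finset.erase_subset k K).trans hKg) (by rw [Finset.card_erase_of_mem hk]; omega)
        (fun h => (Finset.notMem_erase k K) (h hk))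
    have hmono : rkN M (K.erase k) ≤ rkN M K := rkN_mono (Finset.erase_subset k K)
    rw [Finset.card_erase_of_mem hk, hK3] at hKk
    omega
  exact profileIneq_oneCircuit q hq K hKg hK3 hKrk hclass'

/-- THEOREM 𝒞(q), independence form, the row alone. -/
theorem profileIneq_oneCircuit_indep' (q : ℕ) (hq : 2 ≤ q) (K : Finset α) (hKE : (K : Set α) ⊆ M.E) (hK3 : K.card = 3)
    (hKdep : ¬ M.Indep (K : Set α))
    (hclass : ∀ X : Finset α, (X : Set α) ⊆ M.E → X.card ≤ q + 2 → ¬ K ⊆ X → M.Indep (X : Set α)) :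
    Profile.ProfileIneq M q (q + 1) :=
  (profileIneq_oneCircuit_indep q hq K hKE hK3 hKdep hclass).1

/-- THEOREM 𝒞(q), independence form, the Hall form. -/
theorem hallIneq_oneCircuit_indep (q : ℕ) (hq : 2 ≤ q) (K : Finset α) (hKE : (K : Set α) ⊆ M.E) (hK3 : K.card = 3)
    (hKdep : ¬ M.Indep (K : Set α))
    (hclass : ∀ X : Finset α, (X : Set α) ⊆ M.E → X.card ≤ q + 2 → ¬ K ⊆ X → M.Indep (X : Set α)) :
    Profile.HallIneq M q (q + 1) :=
  (profileIneq_oneCircuit_indep q hq K hKE hK3 hKdep hclass).2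

/-- The row `(6, 7)` on 𝒞(6) — in particular on `M₆` (14 points), where the simple rule fails. -/
theorem profileIneq_six_seven_oneCircuit (K : Finset α) (hKE : (K : Set α) ⊆ M.E) (hK3 : K.card = 3)
    (hKdep : ¬ M.Indep (K : Set α))
    (hclass : ∀ X : Finset α, (X : Set α) ⊆ M.E → X.card ≤ 8 → ¬ K ⊆ X → M.Indep (X : Set α)) :
    Profile.ProfileIneq M 6 7 :=
  profileIneq_oneCircuit_indep' 6 (by norm_num) K hKE hK3 hKdep hclass

/-- The row `(7, 8)` on 𝒞(7). -/
theorem profileIneq_seven_eight_oneCircuit (K : Finset α) (hKE : (K : Set α) ⊆ M.E) (hK3 : K.card = 3)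
    (hKdep : ¬ M.Indep (K : Set α))
    (hclass : ∀ X : Finset α, (X : Set α) ⊆ M.E → X.card ≤ 9 → ¬ K ⊆ X → M.Indep (X : Set α)) :
    Profile.ProfileIneq M 7 8 :=
  profileIneq_oneCircuit_indep' 7 (by norm_num) K hKE hK3 hKdep hclass

/-- The row `(8, 9)` on 𝒞(8). -/
theorem profileIneq_eight_nine_oneCircuit (K : Finset α) (hKE : (K : Set α) ⊆ M.E) (hK3 : K.card = 3)
    (hKdep : ¬ M.Indep (K : Set α))
    (hclass : ∀ X : Finset α, (X : Set α) ⊆ M.E → X.card ≤ 10 → ¬ K ⊆ X → M.Indep (X : Set α)) :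
    Profile.ProfileIneq M 8 9 :=
  profileIneq_oneCircuit_indep' 8 (by norm_num) K hKE hK3 hKdep hclass

end OneCircuit
end PercRepro
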